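import Summits.CriticalPhenomena.PercolationContinuityZ3.Theorems.PercNearOneGluingNoHeavyLowerTailSahiCombCylinder
import Summits.CriticalPhenomena.PercolationContinuityZ3.Theorems.PercNearOneGluingNoHeavyLowerTailSahiCombRange

/-!
# The comb (tensor-Bernstein) hierarchy for Sahi's `E_k`, XVIII: CYLINDER PADDING over a freeze-stable core — AND-events are free on
# top of any class of events that stays comb-positive under simultaneous freezing; all orders for {cylinders} ∪ {three unions of
# independent events} and {AND-events} ∪ {three OR-events}

Support file of the one-cut programme (crux `NoHeavyLowerTail`, stmt-CriticalPhenomena-4575; cell `prim-masterthm`, seat P3, gen 4;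
`run/shared/lean/prim/prim-masterthm/prim-masterthm-p3/HIERARCHY.md` §11).  Vocabulary: `SahiComb.CombPos`; the comb cylinder rung with LOCAL
hypotheses `combPos_sahiE_ind_cylinder_head_local` (`…SahiCombCylinder`, gen 2: Blinovsky's conditioning identity in division-free form —
conditioning the product weight on the cylinder `{S ⊆ ω}` FREEZES the coordinates of `S`, `X ↦ X^{S←1} = secUnion S X`); range lifting
`SahiCombRange.combPos_sahiE_ind_of_range_three` (`…SahiCombRange`, gen 4).

THE POINT.  Peeling a cylinder member `{S ⊆ ω}` costs nothing at the comb level provided every sub-family of the SIMULTANEOUSLY FROZEN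
remaining family `(U_j^{S←1})_j` is comb-positive.  So if a class of increasing events is indexed by the frozen set — `K S X` — with
`K S X → K (S ∪ S') (X^{S'←1})` and every family drawn from `{X | K S X}` comb-positive (for each `S`), then cylinders can be added to such
families freely, at every order (strong induction on the size; frozen cylinders are cylinders, `secUnion_cylinder`):

* **`combPos_sahiE_ind_cylinders_over`** — the padding theorem (all `n`; Blinovsky's "two free slots" had the core = any two increasing
  events; here the core is any freeze-stable comb-positive class).
* **`combPos_sahiE_ind_cylinders_over_three`** — core = all families drawn from THREE increasing events `V_0,V_1,V_2` whose frozen cubic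
  rows `E_3(1_{V_0^{S←1}},1_{V_1^{S←1}},1_{V_2^{S←1}})` are comb-positive for every `S` (range lifting makes the multiplicities free).
* UNCONDITIONAL ROWS (standard axioms): **`combPos_sahiE_ind_cylinders_unions_three`** — every family each of whose members is a cylinder
  `{S_j ⊆ ω}` or one of three unions `⋃_{a∈A_k} H_a` of independent increasing events is comb-positive at its size, EVERY size (freezing
  preserves the structure: `secUnion S (⋃ H_a) = ⋃ secUnion S H_a`, each again increasing and `D_a`-determined; cubic rows by
  `…SahiCombVennThree`); **`combPos_sahiE_ind_and_or_three`** — AND-events of coordinates are free on top of any multiset drawn from three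
  OR-events of coordinates: `E_n ≥ 0` for every family of events `{S_j ⊆ ω}` and `{ω ∩ T_k ≠ ∅}` (`k < 3`), every `n`, every product
  measure (Sahi's Theorem 2 is the case without OR-events); `combPos_sahiE_ind_cylinders_junta_three` (core = a junta-intersection
  triple of prim-l12 P3's `…SahiCombJunta`, which freezing preserves).  Law-level shadows.
HONEST FRAMING: nothing here asserts (M⁺-k) or `C_k` for `k ≥ 3` in general. [this work]
-/

noncomputable section

open scoped Classical

namespace Summit.CriticalPhenomena.PercolationContinuityZ3.Theorems

open Finset Function
open Literature.Combinatorics.Sahi2008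
open Literature.Probability.Percolation (DeterminedBy determinedBy_iff)
open Literature.Probability.Percolation.DecisionTree (ind)
open SahiComb

variable {ι : Type} [Fintype ι]

namespace SahiCombPadding

/-! ### Freezing algebra -/

omit [Fintype ι] in
/-- Freezing twice is freezing by the union: `(X^{S←1})^{S'←1} = X^{(S ∪ S')←1}`. [folklore] -/
theorem secUnion_secUnion (S S' : Set ι) (X : Set (Set ι)) : secUnion S' (secUnion S X) = secUnion (S ∪ S') X := by
  ext ω
  simp only [mem_secUnion, Set.union_assoc, Set.union_comm S' S]

omit [Fintype ι] in
/-- Freezing by `∅` does nothing. [folklore] -/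
theorem secUnion_empty (X : Set (Set ι)) : secUnion ∅ X = X := by
  ext ω; simp only [mem_secUnion, Set.union_empty]

omit [Fintype ι] in
/-- Freezing distributes over indexed unions. [folklore] -/
theorem secUnion_biUnion {A : Type*} (S : Set ι) (𝒜 : Finset A) (H : A → Set (Set ι)) :
    secUnion S (⋃ a ∈ 𝒜, H a) = ⋃ a ∈ 𝒜, secUnion S (H a) := by
  ext ω; simp only [mem_secUnion, Set.mem_iUnion, exists_prop]

omit [Fintype ι] in
/-- Freezing preserves `W`-determinedness. [folklore] -/
theorem determinedBy_secUnion_of_determinedBy (S : Set ι) {X : Set (Set ι)} {W : Set ι} (hX : DeterminedBy X W) :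
    DeterminedBy (secUnion S X) W := by
  rw [determinedBy_iff] at hX ⊢
  intro ω ω' h
  simp only [mem_secUnion]
  refine hX _ _ ?_
  rw [Set.union_inter_distrib_right, Set.union_inter_distrib_right, h]

/-! ### The padding theorem -/

/-- **CYLINDER PADDING OVER A FREEZE-STABLE CORE (every order).**  Let `K S X` be a predicate ("`X` is a core event at freezing level `S`")
such that core events are increasing, `K S X → K (S ∪ S') (X^{S'←1})`, and for every `S` every family of `K S`-events has `E_n`
comb-positive at multidegree `n`.  Then every family each of whose members is a CYLINDER `{S' ⊆ ω}` or a `K S`-event has `E_n`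
comb-positive at multidegree `n`, for every `n` and every `S`. [this work] -/
theorem combPos_sahiE_ind_cylinders_over (K : Set ι → Set (Set ι) → Prop) (hKup : ∀ S X, K S X → IsUpperSet X)
    (hKfr : ∀ S S' X, K S X → K (S ∪ S') (secUnion S' X))
    (hKpos : ∀ (S : Set ι) (n : ℕ) (W : Fin n → Set (Set ι)), (∀ j, K S (W j)) →
      CombPos (fun _ : ι => n) (fun p => sahiE (bernoulliWeight p) n (fun j => ind (W j)))) :
    ∀ (n : ℕ) (S : Set ι) (U : Fin n → Set (Set ι)), (∀ j, (∃ S' : Set ι, U j = {ω : Set ι | S' ⊆ ω}) ∨ K S (U j)) →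
      CombPos (fun _ : ι => n) (fun p => sahiE (bernoulliWeight p) n (fun j => ind (U j))) := by
  intro n
  induction n using Nat.strong_induction_on with
  | _ n ih =>
    intro S U hU
    have hUup : ∀ j, IsUpperSet (U j) := fun j => by
      rcases hU j with ⟨S', hS'⟩ | hK
      · rw [hS']; exact fun _ _ hle hω => Set.Subset.trans hω hle
      · exact hKup S _ hK
    by_cases hall : ∀ j, K S (U j)
    · exact hKpos S n U hall
    · obtain ⟨m, hm⟩ := not_forall.1 hall
      obtain ⟨S', hS'⟩ := (hU m).resolve_right hm
      by_cases hn : n ≤ 2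
      · exact masterFamilyCombPos_of_le_two hn ι U hUup
      · obtain ⟨k, rfl⟩ : ∃ k, n = k + 2 := ⟨n - 2, by omega⟩
        obtain ⟨τ, hτ⟩ := exists_perm_forall_sahiE_ind_eq_cons U m
        set V : Fin (k + 1) → Set (Set ι) := fun j => U (m.succAbove (τ j)) with hV
        have hVup : ∀ j, IsUpperSet (V j) := fun j => hUup _
        have h := combPos_sahiE_ind_cylinder_head_local S' V hVup fun T => ?_
        · exact h.congr fun p => by rw [hτ (bernoulliWeight p), hS']
        · -- the frozen sub-family is again cylinders + core events at level `S ∪ S'`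
          refine ih T.card (lt_of_le_of_lt (by simpa using Finset.card_le_univ T) (by omega)) (S ∪ S') _ fun j => ?_
          rcases hU (m.succAbove (τ (T.orderEmbOfFin rfl j))) with ⟨S'', hS''⟩ | hK
          · exact Or.inl ⟨S'' \ S', by simp only [hV, hS'', secUnion_cylinder]⟩
          · exact Or.inr (hKfr S S' _ hK)

/-- **Cylinder padding over THREE EVENTS.**  For increasing `V_0, V_1, V_2` whose frozen cubic rows `E_3(1_{V^{S←1}})` are comb-positive for
every `S ⊆ ι`: every family each of whose members is a cylinder `{S' ⊆ ω}` or one of `V_0, V_1, V_2` (any multiplicities, any order) has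
`E_n` comb-positive at multidegree `n`. [this work] -/
theorem combPos_sahiE_ind_cylinders_over_three (V : Fin 3 → Set (Set ι)) (hV : ∀ k, IsUpperSet (V k))
    (h3 : ∀ S : Set ι, CombPos (fun _ : ι => 3) (fun p => sahiE (bernoulliWeight p) 3 (fun k => ind (secUnion S (V k)))))
    {n : ℕ} (U : Fin n → Set (Set ι)) (hU : ∀ j, (∃ S' : Set ι, U j = {ω : Set ι | S' ⊆ ω}) ∨ ∃ k, U j = V k) :
    CombPos (fun _ : ι => n) (fun p => sahiE (bernoulliWeight p) n (fun j => ind (U j))) := by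
  refine combPos_sahiE_ind_cylinders_over (fun S X => ∃ k, X = secUnion S (V k))
    (fun S X ⟨k, hk⟩ => hk ▸ isUpperSet_secUnion S (hV k))
    (fun S S' X ⟨k, hk⟩ => ⟨k, by rw [hk, secUnion_secUnion]⟩)
    (fun S n W hW => SahiCombRange.combPos_sahiE_ind_of_range_three (fun k => secUnion S (V k))
      (fun k => isUpperSet_secUnion S (hV k)) W hW (h3 S))
    n ∅ U fun j => ?_
  rcases hU j with hc | ⟨k, hk⟩
  · exact Or.inl hc
  · exact Or.inr ⟨k, by rw [hk, secUnion_empty]⟩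

/-- Law-level shadow of `combPos_sahiE_ind_cylinders_over_three`. [this work] -/
theorem sahiE_ind_nonneg_cylinders_over_three (p : ι → unitInterval) (V : Fin 3 → Set (Set ι)) (hV : ∀ k, IsUpperSet (V k))
    (h3 : ∀ S : Set ι, CombPos (fun _ : ι => 3) (fun p => sahiE (bernoulliWeight p) 3 (fun k => ind (secUnion S (V k)))))
    {n : ℕ} (U : Fin n → Set (Set ι)) (hU : ∀ j, (∃ S' : Set ι, U j = {ω : Set ι | S' ⊆ ω}) ∨ ∃ k, U j = V k) :
    0 ≤ sahiE (bernoulliWeight p) n (fun j => ind (U j)) :=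
  (combPos_sahiE_ind_cylinders_over_three V hV h3 U hU).nonneg p

/-! ### Unconditional rows -/

section Unions

variable {A : Type} [Fintype A]

/-- **ALL ORDERS FOR {CYLINDERS} ∪ {THREE UNIONS OF INDEPENDENT INCREASING EVENTS}.**  Let `(H_a)_{a∈A}` be increasing events determined by
pairwise disjoint coordinate sets and `A_0, A_1, A_2 ⊆ A`.  Every family each of whose members is a cylinder `{S_j ⊆ ω}` or one of the three
unions `⋃_{a ∈ A_k} H_a` has `E_n(μ_q)` comb-positive at multidegree `n`, every `n` (standard axioms). [this work] -/
theorem combPos_sahiE_ind_cylinders_unions_three (H : A → Set (Set ι)) (hHup : ∀ a, IsUpperSet (H a)) (D : A → Finset ι)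
    (hD : ∀ a b, a ≠ b → Disjoint (D a) (D b)) (hH : ∀ a, DeterminedBy (H a) (↑(D a) : Set ι)) (𝒜 : Fin 3 → Finset A)
    {n : ℕ} (U : Fin n → Set (Set ι)) (hU : ∀ j, (∃ S' : Set ι, U j = {ω : Set ι | S' ⊆ ω}) ∨ ∃ k, U j = ⋃ a ∈ 𝒜 k, H a) :
    CombPos (fun _ : ι => n) (fun q => sahiE (bernoulliWeight q) n (fun j => ind (U j))) := by
  refine combPos_sahiE_ind_cylinders_over_three (fun k => ⋃ a ∈ 𝒜 k, H a) (fun _ => isUpperSet_iUnion₂ fun a _ => hHup a)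
    (fun S => ?_) U hU
  have h := SahiCombVenn.combPos_sahiE_three_unions (fun a => secUnion S (H a)) D hD
    (fun a => determinedBy_secUnion_of_determinedBy S (hH a)) 𝒜
  refine h.congr fun q => ?_
  congr 1; funext k; rw [secUnion_biUnion]

/-- Law-level shadow: Sahi's `E_n(μ_q) ≥ 0`, every `n`, for families of cylinders and three unions of independent increasing events.
[this work] -/
theorem sahiE_ind_nonneg_cylinders_unions_three (q : ι → unitInterval) (H : A → Set (Set ι)) (hHup : ∀ a, IsUpperSet (H a))
    (D : A → Finset ι) (hD : ∀ a b, a ≠ b → Disjoint (D a) (D b)) (hH : ∀ a, DeterminedBy (H a) (↑(D a) : Set ι))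
    (𝒜 : Fin 3 → Finset A) {n : ℕ} (U : Fin n → Set (Set ι))
    (hU : ∀ j, (∃ S' : Set ι, U j = {ω : Set ι | S' ⊆ ω}) ∨ ∃ k, U j = ⋃ a ∈ 𝒜 k, H a) :
    0 ≤ sahiE (bernoulliWeight q) n (fun j => ind (U j)) :=
  (combPos_sahiE_ind_cylinders_unions_three H hHup D hD hH 𝒜 U hU).nonneg q

end Unions

/-- **AND-EVENTS ARE FREE ON TOP OF THREE OR-EVENTS (every order).**  For `T_0, T_1, T_2 ⊆ ι`: every family each of whose members is an
AND-event `{ω | S_j ⊆ ω}` or one of the OR-events `{ω | ω ∩ T_k ≠ ∅}` has `q ↦ E_n(μ_q; 1_U)` comb-positive at multidegree `n` — Sahi's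
Theorem 2 (all members AND-events) with up to three distinct disjunctions mixed in, any multiplicities. [this work] -/
theorem combPos_sahiE_ind_and_or_three (T : Fin 3 → Finset ι) {n : ℕ} (U : Fin n → Set (Set ι))
    (hU : ∀ j, (∃ S' : Set ι, U j = {ω : Set ι | S' ⊆ ω}) ∨ ∃ k, U j = {ω : Set ι | ∃ i ∈ T k, i ∈ ω}) :
    CombPos (fun _ : ι => n) (fun q => sahiE (bernoulliWeight q) n (fun j => ind (U j))) := by
  classical
  have key := combPos_sahiE_ind_cylinders_unions_three (A := ι) (fun i => {ω : Set ι | i ∈ ω}) (fun i _ _ hle hω => hle hω)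
    (fun i => {i}) (fun a b hab => Finset.disjoint_singleton.2 hab)
    (fun i => (determinedBy_iff _ _).2 fun ω ω' hωω' => ?_) T U fun j => ?_
  · exact key
  · have h1 := Set.ext_iff.1 hωω' i
    simp only [Finset.coe_singleton, Set.mem_inter_iff, Set.mem_singleton_iff, and_true, Set.mem_setOf_eq] at h1 ⊢
    exact h1
  · rcases hU j with hc | ⟨k, hk⟩
    · exact Or.inl hc
    · refine Or.inr ⟨k, ?_⟩
      rw [hk]; ext ω
      simp only [Set.mem_setOf_eq, Set.mem_iUnion, exists_prop]

/-- Law-level shadow: `E_n(μ_q) ≥ 0` for every family of AND-events and (up to three distinct) OR-events of coordinates, every `n`, every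
product measure. [this work] -/
theorem sahiE_ind_nonneg_and_or_three (q : ι → unitInterval) (T : Fin 3 → Finset ι) {n : ℕ} (U : Fin n → Set (Set ι))
    (hU : ∀ j, (∃ S' : Set ι, U j = {ω : Set ι | S' ⊆ ω}) ∨ ∃ k, U j = {ω : Set ι | ∃ i ∈ T k, i ∈ ω}) :
    0 ≤ sahiE (bernoulliWeight q) n (fun j => ind (U j)) :=
  (combPos_sahiE_ind_and_or_three T U hU).nonneg q

/-- **Cylinders over a junta-intersection triple** (prim-l12 P3's row, frozen rows included): for increasing `X, A, B` with `A ∩ B` determined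
by at most three coordinates, every family of cylinders and members of `{X, A, B}` is comb-positive at every order. [this work] -/
theorem combPos_sahiE_ind_cylinders_junta_three (W : Finset ι) (hW : W.card ≤ 3) {X A B : Set (Set ι)}
    (hX : IsUpperSet X) (hA : IsUpperSet A) (hB : IsUpperSet B) (hK : DeterminedBy (A ∩ B) (↑W : Set ι))
    {n : ℕ} (U : Fin n → Set (Set ι)) (hU : ∀ j, (∃ S' : Set ι, U j = {ω : Set ι | S' ⊆ ω}) ∨ ∃ k, U j = (![X, A, B] : Fin 3 → _) k) :
    CombPos (fun _ : ι => n) (fun p => sahiE (bernoulliWeight p) n (fun j => ind (U j))) := by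
  refine combPos_sahiE_ind_cylinders_over_three ![X, A, B] (fun k => by fin_cases k <;> assumption) (fun S => ?_) U hU
  have hKS : DeterminedBy (secUnion S A ∩ secUnion S B) (↑W : Set ι) := by
    rw [← secUnion_inter]; exact determinedBy_secUnion_of_determinedBy S hK
  refine (SahiCombJunta.combPos_sahiE_three_of_inter_determinedBy_card_le_three W hW (isUpperSet_secUnion S hX)
    (isUpperSet_secUnion S hA) (isUpperSet_secUnion S hB) hKS).congr fun p => ?_
  congr 1; funext k; fin_cases k <;> rfl

end SahiCombPadding

end Summit.CriticalPhenomena.PercolationContinuityZ3.Theorems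

end
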